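import Summits.HodgeConjecture.CorCM.Census.CyclicCharacterEvenTiePairs

/-!
# Cyclic characters, XXXI: EVEN KERNEL, toward `d = 0` — THE ζ-CERTIFICATE with `β − 2ᵏ⁻¹` faces

COR-CM (cell `pub-hodgecm2`), count-neutral kernel combinatorics by the binder seat b09 (gen 43; lane CYCLIC-CHARACTER FIBRE LAW, part XXXI), on parts XXIV, XXV, XXVIa,
XXX and gen 38/39ʼs covering on a set BY NAME.  Theorems only (no definition, no `decide`, no certificate, no named fact, no `sorry`).
HONEST FRAMING: `HC_CM` is NOT proved, here or anywhere in the tree; nothing here is a period or a headline.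

**THE ζ-CERTIFICATE (`exists_zetaCert`).**  For `w ↠ ℤ/2ᵏ` (`k ≥ 2`), `w c ≠ 0`, kernel of EVEN size `2m ≥ 4`: a face family `S₀` with `|S₀| + 2ᵏ⁻¹ ≤ β(G, c)` (for
`k = 2`: `|S₀| ≤ β − 2 = φ₂` when `d = 0`) such that `L = ℤ⟨pairs⟩ + ℤ[G]·S₀` has the toward property through every type of potential `≥ 2` AND contains
`ζ_s = ε_s + η_s` for every bottom point `s`.  Construction: two ADJACENT ties `X_C`, `X_{C∖b∪v}` in different blocks (part XXX); gen 38ʼs cover of every far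
block except that of `X_C`; read the coverʼs orientation at `X_{C∖b∪v}` (down or up, part XXIV) and own `X_C` with the OPPOSITE explicit face (ascending
`gface X_C v v'`, resp. descending `gface X_C b b'`); the even three-across face `gface X_C^{(b)} b v` then yields `ζ_v`, resp. `ζ_b` (parts XXX/XXV), and
kernel translation gives every `ζ_s`.
WHAT IT IS FOR: the genʼs numerics (`HOME/pub-hodgecm2-b09/lean-g43/py/d0implic.py`, `d0random.py`) say that for `d = 0` such an `L` is ALREADY the whole Hodge
lattice (20/20 random covers in every row computed), which would give `μ = φ₂` for `d = 0`; the algebraic statement «`d = 0`, toward property, `ζ ∈ L` ⟹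
`hodgeSpan ≤ L`» is OPEN (mechanism: the balanced types with an odd stabiliser element, `EVEN-KERNEL-ROADMAP.md`).  For `d = 1` it is false (ℤ/4 ⋊ ℤ/4, `c = y²`).

## References
* [Pohlmann1968] H. Pohlmann, Algebraic cycles on abelian varieties of complex multiplication type, Ann. of Math. 88 (1968), Thm 1.
-/

namespace Summit.HodgeConjecture.CorCM.Census.CyclicCharacter

open Finset
open Summit.HodgeConjecture.CorCM.Prior.AllgGroup.RfwfAllgGroup
open Summit.HodgeConjecture.CorCM.Census.BlockParity
open Summit.HodgeConjecture.CorCM.Census.Coinvariant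
open Summit.HodgeConjecture.CorCM.Census.TwistGeneration
open Summit.HodgeConjecture.CorCM.Census.Nondegenerate
open Summit.HodgeConjecture.CorCM.Census.BaseBlock

noncomputable section

variable {G : Type*} [Group G] [Fintype G] [DecidableEq G] {k : ℕ} {w : G → ZMod (2 ^ k)} {c : G}

/-- **THE ζ-CERTIFICATE** (see the file header): `β − 2ᵏ⁻¹` faces whose lattice has the toward property and contains every `ζ_s`. [folklore] -/
theorem exists_zetaCert [Fintype (CMF G c)] (hw : ∀ P Q : G, w (P * Q) = w P + w Q) (hk : 1 ≤ k) (hk2 : 2 ≤ k)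
    (hc2 : c * c = 1) (hcen : ∀ x : G, x * c = c * x) (hwc : w c ≠ 0) (h1 : ∃ g₁ : G, w g₁ = 1)
    {m : ℕ} (hm : 2 * m = (univ.filter fun s : G => w s = 0).card) (hm2 : 2 ≤ m) :
    ∃ S₀ : Finset (CMF G c →₀ ℤ), (↑S₀ ⊆ gfaceSet G c hc2) ∧ S₀.card + 2 ^ (k - 1) ≤ Fintype.card (Block c) ∧
      (∀ Φ : CMF G c, 2 ≤ bpot c (arcType hw hk hc2 hwc 0) Φ → ∃ Q s s' : G,
        bpot c (arcType hw hk hc2 hwc 0) Φ = ddist (rt c Q (arcType hw hk hc2 hwc 0)) Φ ∧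
          s ∈ (rt c Q (arcType hw hk hc2 hwc 0)).1 \ Φ.1 ∧ s' ∈ (rt c Q (arcType hw hk hc2 hwc 0)).1 \ Φ.1 ∧ s ≠ s' ∧
            gface c hc2 Φ s s' ∈ Submodule.span ℤ (pairSet c) ⊔ Submodule.span ℤ (translates c S₀)) ∧
      ∀ s : G, w s = 0 →
        (Finsupp.single (oflipCM c hc2 s (arcType hw hk hc2 hwc 0)) (1 : ℤ) - Finsupp.single (arcType hw hk hc2 hwc 0) 1) +
          (Finsupp.single (oflipCM c hc2 s (arcType hw hk hc2 hwc 1)) (1 : ℤ) - Finsupp.single (arcType hw hk hc2 hwc 1) 1) ∈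
            Submodule.span ℤ (pairSet c) ⊔ Submodule.span ℤ (translates c S₀) := by
  classical
  obtain ⟨Qm, hQm⟩ := exists_apply_eq hw h1 (-1)
  have eT₁ : arcType hw hk hc2 hwc 1 = rt c Qm (arcType hw hk hc2 hwc 0) := arcType_eq_rt hw hk hc2 hwc hQm
  have hn2 : 2 ≤ (univ.filter fun s : G => w s = 0).card := by omega
  have hwc' : ∀ x : G, w x = 0 → ∀ y : G, w y = 0 → y ≠ c * x := fun x hx y hy h => hwc (by
    have := congrArg w h; rw [hw, hx, hy, add_zero] at this; exact this.symm)
  -- the tie `X_C` and an adjacent tie `X'' = X_{C∖b∪v}` in another block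
  obtain ⟨C, hCF, hCc⟩ := exists_subset_card_eq (s := (univ.filter fun s : G => w s = 0)) (n := m) (by omega)
  have hCm : 2 * C.card = (univ.filter fun s : G => w s = 0).card := by rw [hCc]; exact hm
  have hC2 : 2 ≤ C.card := by omega
  obtain ⟨X, hX⟩ := exists_sdiff_eq_of_subset_fibre hw hk hc2 hwc C hCF
  obtain ⟨b, hb, v, hv, hblkne⟩ := exists_adjacent_tie_blk_ne hw hk hk2 hc2 hwc h1 hCF hCm hC2 hX
  obtain ⟨b', hb', hbb'⟩ : ∃ b' ∈ C, b' ≠ b := by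
    obtain ⟨x, hx, y, hy, hxy⟩ := one_lt_card.mp (by omega : 1 < C.card)
    by_cases h : x = b
    · exact ⟨y, hy, fun e => hxy (h.trans e.symm)⟩
    · exact ⟨x, hx, h⟩
  have hUc : ((univ.filter fun s : G => w s = 0) \ C).card = m := by have := card_sdiff_add_card_eq_card hCF; omega
  obtain ⟨v', hv', hvv'⟩ : ∃ v' ∈ (univ.filter fun s : G => w s = 0) \ C, v' ≠ v := by
    obtain ⟨x, hx, y, hy, hxy⟩ := one_lt_card.mp (by omega : 1 < ((univ.filter fun s : G => w s = 0) \ C).card)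
    by_cases h : x = v
    · exact ⟨y, hy, fun e => hxy (h.trans e.symm)⟩
    · exact ⟨x, hx, h⟩
  have hb0 : w b = 0 := (mem_filter.mp (hCF hb)).2
  have hb'0 : w b' = 0 := (mem_filter.mp (hCF hb')).2
  have hv0 : w v = 0 := (mem_filter.mp (mem_sdiff.mp hv).1).2
  have hv'0 : w v' = 0 := (mem_filter.mp (mem_sdiff.mp hv').1).2
  have hvC : v ∉ C := (mem_sdiff.mp hv).2
  have hv'C : v' ∉ C := (mem_sdiff.mp hv').2
  have hbv : b ≠ v := fun h => hvC (h ▸ hb)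
  have hbT : b ∈ (arcType hw hk hc2 hwc 0).1 := (mem_arcType_zero_and_notMem_one hw hk hc2 hwc hb0).1
  have hbX : b ∉ X.1 := fun h => (mem_sdiff.mp (hX.symm ▸ hb : b ∈ (arcType hw hk hc2 hwc 0).1 \ X.1)).2 h
  have hX' : (arcType hw hk hc2 hwc 0).1 \ (oflipCM c hc2 b X).1 = C.erase b := by rw [dev_oflip c hc2 hbT hbX, hX]
  have hX'b : oflipCM c hc2 b (oflipCM c hc2 b X) = X := oflipCM_oflipCM_self c hc2 b X
  have hX'' : (arcType hw hk hc2 hwc 0).1 \ (oflipCM c hc2 v (oflipCM c hc2 b X)).1 = insert v (C.erase b) :=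
    sdiff_oflipCM_eq_insert hw hk hc2 hwc hX' hv0 (fun h => hvC (mem_of_mem_erase h))
  have hCv : insert v (C.erase b) ⊆ univ.filter fun s : G => w s = 0 := insert_subset (mem_sdiff.mp hv).1 ((erase_subset b C).trans hCF)
  have hcv : (insert v (C.erase b)).card = C.card := by
    rw [card_insert_of_notMem (fun h => hvC (mem_of_mem_erase h))]; exact card_erase_add_one hb
  have h2X : 2 * ((arcType hw hk hc2 hwc 0).1 \ X.1).card = (univ.filter fun s : G => w s = 0).card := by rw [hX]; exact hCm
  have h2X'' : 2 * ((arcType hw hk hc2 hwc 0).1 \ (oflipCM c hc2 v (oflipCM c hc2 b X)).1).card = (univ.filter fun s : G => w s = 0).card := by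
    rw [hX'', hcv]; exact hCm
  have hpotX : bpot c (arcType hw hk hc2 hwc 0) X = m := by rw [bpot_eq_of_tie hw hk hc2 hwc h2X, hX, hCc]
  have hpotX'' : bpot c (arcType hw hk hc2 hwc 0) (oflipCM c hc2 v (oflipCM c hc2 b X)) = m := by
    rw [bpot_eq_of_tie hw hk hc2 hwc h2X'', hX'', hcv, hCc]
  have hne : blk c (oflipCM c hc2 v (oflipCM c hc2 b X)) ≠ blk c X := hblkne _ hX''
  -- `T_1 ∖ X = c·(F_0 ∖ C)`
  have hT1X := sdiff_arcType_one_eq_image hw hk hc2 hwc X (hX.symm ▸ hCF)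
  rw [hX] at hT1X
  -- gen 38ʼs cover of the far blocks other than the block of `X`, and its datum at `X''`
  obtain ⟨Sc, hScf, hScc, -, -, -, htwc⟩ := exists_joint_cover_on c (arcType hw hk hc2 hwc 0) hc2
    (fun Bk : Block c => 2 ≤ bpot c (arcType hw hk hc2 hwc 0) Bk.out ∧ Bk ≠ blk c X) (fun _ h => h.1) ∅
    (by rw [Finset.coe_empty]; exact linearIndepOn_empty _ _) (fun f hf => absurd hf (Finset.notMem_empty f))
  obtain ⟨Q, s, s', hQ, hs, hs', hss', hfQ⟩ := htwc _ le_rfl (oflipCM c hc2 v (oflipCM c hc2 b X))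
    (by rw [bpot_out, hpotX'']; exact ⟨hm2, hne⟩)
  have hQd : ddist (rt c Q (arcType hw hk hc2 hwc 0)) (oflipCM c hc2 v (oflipCM c hc2 b X)) =
      ((arcType hw hk hc2 hwc 0).1 \ (oflipCM c hc2 v (oflipCM c hc2 b X)).1).card := by rw [← hQ, bpot_eq_of_tie hw hk hc2 hwc h2X'']
  -- the explicit face at `X`, opposite to the coverʼs orientation at `X''`
  set fX : CMF G c →₀ ℤ := if rt c Q (arcType hw hk hc2 hwc 0) = arcType hw hk hc2 hwc 0 then gface c hc2 X v v' else gface c hc2 X b b' with hfX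
  have hfXmem : fX ∈ gfaceSet G c hc2 := by
    rw [hfX]; split_ifs
    · exact ⟨X, v, v', by rw [mem_orb]; push Not; exact ⟨hvv', hwc' v hv0 v' hv'0⟩, rfl⟩
    · exact ⟨X, b, b', by rw [mem_orb]; push Not; exact ⟨hbb', hwc' b hb0 b' hb'0⟩, rfl⟩
  have hf3 : gface c hc2 (oflipCM c hc2 b X) b v ∈ gfaceSet G c hc2 :=
    ⟨oflipCM c hc2 b X, b, v, by rw [mem_orb]; push Not; exact ⟨hbv.symm, hwc' b hb0 v hv0⟩, rfl⟩
  set S₀ : Finset (CMF G c →₀ ℤ) := Sc ∪ {fX, gface c hc2 (oflipCM c hc2 b X) b v} with hS₀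
  have hS₀f : (↑S₀ : Set (CMF G c →₀ ℤ)) ⊆ gfaceSet G c hc2 := by
    intro f hf
    rw [hS₀, coe_union, Set.mem_union] at hf
    rcases hf with hf | hf
    · exact hScf hf
    · simp only [coe_insert, coe_singleton, Set.mem_insert_iff, Set.mem_singleton_iff] at hf
      rcases hf with rfl | rfl; exacts [hfXmem, hf3]
  have hScS : Sc ⊆ S₀ := subset_union_left
  have hXS : fX ∈ S₀ := by rw [hS₀]; exact mem_union_right _ (mem_insert_self _ _)
  have h3S : gface c hc2 (oflipCM c hc2 b X) b v ∈ S₀ := by rw [hS₀]; exact mem_union_right _ (mem_insert_of_mem (mem_singleton_self _))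
  have hsubSc : Submodule.span ℤ (translates c Sc) ≤ Submodule.span ℤ (pairSet c) ⊔ Submodule.span ℤ (translates c S₀) :=
    (Submodule.span_mono fun y hy => by obtain ⟨Q', f, hf, e⟩ := hy; exact ⟨Q', f, hScS hf, e⟩).trans le_sup_right
  have hL := fun f (hf : f ∈ S₀) => (Submodule.mem_sup_right (mem_span_translates_of_mem c S₀ hf) :
    f ∈ Submodule.span ℤ (pairSet c) ⊔ Submodule.span ℤ (translates c S₀))
  set L := Submodule.span ℤ (pairSet c) ⊔ Submodule.span ℤ (translates c S₀) with hLdef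
  have hfXL : ∀ Q' : G, Finsupp.mapDomain (rt c Q') fX ∈ L := fun Q' => Submodule.mem_sup_right (Submodule.subset_span ⟨Q', _, hXS, rfl⟩)
  -- the toward property: cover on the far blocks, the explicit face on the block of `X` (down or up)
  have htw : ∀ Φ : CMF G c, 2 ≤ bpot c (arcType hw hk hc2 hwc 0) Φ → ∃ Q s s' : G, bpot c (arcType hw hk hc2 hwc 0) Φ = ddist (rt c Q (arcType hw hk hc2 hwc 0)) Φ ∧
      s ∈ (rt c Q (arcType hw hk hc2 hwc 0)).1 \ Φ.1 ∧ s' ∈ (rt c Q (arcType hw hk hc2 hwc 0)).1 \ Φ.1 ∧ s ≠ s' ∧ gface c hc2 Φ s s' ∈ L := by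
    refine toward_all_of_on c (arcType hw hk hc2 hwc 0) hc2 (fun Bk : Block c => 2 ≤ bpot c (arcType hw hk hc2 hwc 0) Bk.out ∧ Bk ≠ blk c X) _ ?_ ?_
    · exact fun Φ hΦ => htwc _ hsubSc Φ hΦ
    · intro Φ hΦ hnot
      have hblk : blk c Φ = blk c X := by by_contra h; exact hnot ⟨by rw [bpot_out]; exact hΦ, h⟩
      by_cases hdn : rt c Q (arcType hw hk hc2 hwc 0) = arcType hw hk hc2 hwc 0
      · -- `X` owned UP: the ascending face, presented through `T_1 = T_0·Qm⁻¹` and the points `c v`, `c v'`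
        have hfeq : fX = gface c hc2 X (c * v) (c * v') := by rw [hfX, if_pos hdn]; simp only [gface, oflipCM_cmul]
        refine toward_of_explicit c (arcType hw hk hc2 hwc 0) hc2 _ (Q₀ := Qm) (t := c * v) (t' := c * v')
          (by rw [← eT₁, hpotX]; unfold ddist; rw [hT1X, card_image_of_injective _ (mul_right_injective c), hUc])
          (by rw [← eT₁, hT1X]; exact mem_image_of_mem _ hv) (by rw [← eT₁, hT1X]; exact mem_image_of_mem _ hv')
          (fun h => hvv' (mul_left_cancel h).symm) (fun Q' => by rw [← hfeq]; exact hfXL Q') hblk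
      · have hfeq : fX = gface c hc2 X b b' := by rw [hfX, if_neg hdn]
        refine toward_of_explicit c (arcType hw hk hc2 hwc 0) hc2 _ (Q₀ := 1) (t := b) (t' := b')
          (by rw [rt_one, bpot_eq_of_tie hw hk hc2 hwc h2X]; rfl) (by rw [rt_one, hX]; exact hb) (by rw [rt_one, hX]; exact hb') hbb'.symm
          (fun Q' => by rw [← hfeq]; exact hfXL Q') hblk
  refine ⟨S₀, hS₀f, ?_, htw, ?_⟩
  · -- the count `|S₀| ≤ (β − 2ᵏ⁻¹ − 1 − 1) + 2`
    obtain ⟨n₀, n₁, hn₀1, hn₁1, hn₀₁, hn₀, hn₁⟩ := exists_two_ker hw (by omega)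
    have hnear := half_add_one_le_card_filter_bpot_le_one' hw hk hc2 hcen hwc h1 hn₀1 hn₁1 hn₀₁ hn₀ hn₁
    have hsplit := card_filter_add_card_filter_not (s := (univ : Finset (Block c))) (fun Bk : Block c => 2 ≤ bpot c (arcType hw hk hc2 hwc 0) Bk.out)
    have hneg : (univ.filter fun Bk : Block c => ¬ 2 ≤ bpot c (arcType hw hk hc2 hwc 0) Bk.out) = univ.filter fun Bk : Block c => bpot c (arcType hw hk hc2 hwc 0) Bk.out ≤ 1 :=
      filter_congr fun Bk _ => by omega
    rw [hneg, card_univ] at hsplit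
    have hfar : (univ.filter fun Bk : Block c => 2 ≤ bpot c (arcType hw hk hc2 hwc 0) Bk.out ∧ Bk ≠ blk c X) =
        (univ.filter fun Bk : Block c => 2 ≤ bpot c (arcType hw hk hc2 hwc 0) Bk.out).erase (blk c X) := by
      ext Bk; simp only [mem_filter, mem_univ, true_and, mem_erase]; tauto
    have hXfar : blk c X ∈ univ.filter fun Bk : Block c => 2 ≤ bpot c (arcType hw hk hc2 hwc 0) Bk.out := by
      rw [mem_filter, bpot_out, hpotX]; exact ⟨mem_univ _, hm2⟩
    have hfarc := card_erase_add_one hXfar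
    rw [← hfar] at hfarc
    have h2 : ({fX, gface c hc2 (oflipCM c hc2 b X) b v} : Finset (CMF G c →₀ ℤ)).card ≤ 2 := card_insert_le _ _
    have hun := card_union_le Sc ({fX, gface c hc2 (oflipCM c hc2 b X) b v} : Finset (CMF G c →₀ ℤ))
    rw [← hS₀, hScc] at hun
    omega
  · -- `ζ` from the three-across face with its two tie corners in opposite orientations
    have hsmall : 2 * (C.card - 1) < (univ.filter fun s : G => w s = 0).card := by omega
    have hlarge : 2 * ((univ.filter fun s : G => w s = 0).card - C.card - 1) < (univ.filter fun s : G => w s = 0).card := by omega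
    have hζ0 : ∃ s₀ : G, w s₀ = 0 ∧
        (Finsupp.single (oflipCM c hc2 s₀ (arcType hw hk hc2 hwc 0)) (1 : ℤ) - Finsupp.single (arcType hw hk hc2 hwc 0) 1) +
          (Finsupp.single (oflipCM c hc2 s₀ (arcType hw hk hc2 hwc 1)) (1 : ℤ) - Finsupp.single (arcType hw hk hc2 hwc 1) 1) ∈ L := by
      rcases rt_arcType_eq_zero_or_one_of_tie hw hk hk2 hc2 hwc h1 (hX''.symm ▸ hCv) h2X'' (by rw [hX'']; exact ⟨v, mem_insert_self v _⟩) hQd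
        with hdown | hup
      · -- `X''` DOWN by the cover, `X` UP by the explicit ascending face: `ζ_v`
        rw [hdown] at hs hs'
        have eDn := single_sub_normalForm_mem_of_face hw hk hc2 hwc L htw 1 (Φ := oflipCM c hc2 v (oflipCM c hc2 b X))
          (by rw [rt_one]; unfold ddist; omega) (by rw [rt_one]; exact hs) (by rw [rt_one]; exact hs') hss' (hsubSc hfQ)
        rw [rt_one] at eDn
        have hfeq : fX = gface c hc2 X (c * v) (c * v') := by rw [hfX, if_pos hdown]; simp only [gface, oflipCM_cmul]
        have eUp := single_sub_normalForm_mem_of_face hw hk hc2 hwc L htw Qm (Φ := X)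
          (by rw [← eT₁]; unfold ddist; rw [hT1X, card_image_of_injective _ (mul_right_injective c), hUc]; omega)
          (by rw [← eT₁, hT1X]; exact mem_image_of_mem _ hv) (by rw [← eT₁, hT1X]; exact mem_image_of_mem _ hv')
          (fun h => hvv' (mul_left_cancel h).symm) (by rw [← hfeq]; exact hL _ hXS)
        rw [← eT₁] at eUp
        refine ⟨v, hv0, zeta_mem_of_threeAcross_even_up_down hw hk hc2 hwc h1 L htw hb hX' hCF hsmall hlarge hv0 hvC (hL _ h3S)
          (by rw [hX'b]; exact eUp) eDn⟩
      · -- `X''` UP by the cover, `X` DOWN by the explicit descending face: `ζ_b`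
        rw [hup, eT₁] at hs hs'
        have eUp := single_sub_normalForm_mem_of_face hw hk hc2 hwc L htw Qm (Φ := oflipCM c hc2 v (oflipCM c hc2 b X))
          (by rw [← eT₁, ← hup, hQd]; omega) hs hs' hss' (hsubSc hfQ)
        rw [← eT₁] at eUp
        have hT10 : ¬ rt c Q (arcType hw hk hc2 hwc 0) = arcType hw hk hc2 hwc 0 := by
          rw [hup]; intro h
          haveI : NeZero (2 ^ k) := ⟨pow_ne_zero _ two_ne_zero⟩
          haveI : Fact (1 < 2 ^ k) := ⟨Nat.one_lt_two_pow (by omega)⟩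
          exact one_ne_zero (arcType_injective hw hk hc2 hwc h1 h)
        have hfeq : fX = gface c hc2 X b b' := by rw [hfX, if_neg hT10]
        have eDn := single_sub_normalForm_mem_of_face hw hk hc2 hwc L htw 1 (Φ := X)
          (by rw [rt_one]; unfold ddist; rw [hX]; omega) (by rw [rt_one, hX]; exact hb) (by rw [rt_one, hX]; exact hb') hbb'.symm
          (by rw [← hfeq]; exact hL _ hXS)
        rw [rt_one] at eDn
        refine ⟨b, hb0, zeta_mem_of_threeAcross_even_up hw hk hc2 hwc h1 L htw hb hX' hCF hsmall hlarge hv0 hvC (hL _ h3S)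
          (by rw [hX'b]; exact eDn) eUp⟩
    obtain ⟨s₀, hs₀, hζs₀⟩ := hζ0
    intro s hs0
    exact zeta_mem_of_zeta_mem hw hk hc2 hcen hwc S₀ hs₀ hs0 hζs₀

end

end Summit.HodgeConjecture.CorCM.Census.CyclicCharacter
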